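import Literature.IUT.HodgeArakelov.TemperedThetaMonoidsProofs3
import Literature.AnabelianGeometry.AbsoluteAnabelian.MonoidKummerEquivariantModel

/-!
# [IUTchII] §3, Prop 3.1 (ii) — both printed clauses of "the constant monoid `Ψ_cns(M^Θ_*)`" for every
# `ThetaEnvData` whose ambient module is (equivariantly) the MODEL cohomology colimit and whose constants
# are the Kummer image (proof-only; abc-iut cell, layer L6; GAP-LEDGER G-w4d019-1 consumer at the model)

S. Mochizuki, *Inter-universal Teichmüller theory II*, §3, Proposition 3.1 (ii) p. 88 [cite: Mochizuki2012,
Prop 3.1 (ii) p.88]: "one obtains a functorial algorithm `M^Θ_* ↦ Ψ_cns(M^Θ_*) := M_TM(M^Θ_*) ⊆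
lim_J H¹(Π_Ÿ(M^Θ_*)|_J, Π_μ(M^Θ_*))` for constructing a 'monoid of constants' — i.e., which is naturally
isomorphic to `O^▷_{F̄_v}` [cf. Example 1.8, (ii)] — equipped with a natural conjugation action by `Π_X(M^Θ_*)`."
Claim key DISPUTED (D-0012); PROOF-ONLY (no definitions); node **IUTchII:Prop3.1(ii)**; nothing here takes
a side on [IUTchIII] Cor 3.12.

ASSEMBLY of three landed pieces:
* abc-iut-L6-t2's statement file `TemperedThetaMonoids.lean` (`ThetaEnvData E` over `Π`, with its ambient
  module `E.H`, conjugation action `E.conj : Π →* MulAut E.H`, constant monoid `E.constantMonoid`, unit group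
  `E.units`, and the `Prop`-valued clause `Prop31Statements.constants_stable`);
* abc-iut-w4-d007's `MonoidKummerEquivariantModel.lean` ([AbsTopIII] Def. 3.1 (i) / Prop. 3.2 (ii) MODEL over
  Mathlib group cohomology: for an MLF `k`, `k̄`, `ε_k : Π_k ↠ G_k`, the commutative group
  `cohLim C D = Multiplicative (lim→_N H¹(ε_k⁻¹N, Λ(k̄ˣ)))` with its `Π_k`-ACTION `cohLimConj`, and the
  INJECTIVE, `Π_k`-EQUIVARIANT Kummer homomorphism `constantsKummerHom : 𝒪_k̄^▷ →* cohLim C D`);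
* the generic transport theorems of `TemperedThetaMonoidsProofs3.lean`.

HYPOTHESES (all that is left of the printed construction, each a datum/identification, none a `Prop` fact
smuggled): `E : ThetaEnvData Π_k`; an isomorphism of ambient modules `φ : cohLim C D ≃* E.H` that is
`Π_k`-equivariant — THIS is "by applying the cyclotomic rigidity isomorphisms of Corollaries 2.8, (i); 2.9"
(the change of coefficient cyclotome `Λ(k̄ˣ) = μ_Ẑ(G_v) ⥲ Π_μ(M^Θ_*)`, abc-iut-L6-t1's typed isomorphisms;
the last open part of G-w4d019-1); and the DEFINITION of the constants as the Kummer image,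
`E.constants = mrange (φ ∘ κ)` ("`Ψ_cns(M^Θ_*) := M_TM(M^Θ_*)`").  CONCLUSIONS (theorems): the typed clause
`constants_stable` HOLDS (`constants_stable_ofModel`); "naturally isomorphic to `O^▷_{F̄_v}`":
`𝒪_k̄^▷ ≃* Ψ_cns` equal to `φ ∘ κ` on elements, INTERTWINING the `Π_k`-actions, and UNIQUE as such
(`exists_constantMonoid_mulEquiv_ofModel`, `constantMonoid_mulEquiv_ofModel_unique`); and `M^×_TM`
corresponds to the units of `𝒪_k̄^▷` (`kummer_mem_units_iff_ofModel`).
-/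

namespace Literature.IUT.HodgeArakelov

namespace TemperedThetaMonoids

open Literature.AnabelianGeometry.AbsoluteAnabelian

universe v

section Model

variable (C : MLFClosure.{0}) (D : ModelMLFGaloisData C.k C.K) (E : ThetaEnvData.{0, v} D.Pi)
  (φ : ModelMLFGaloisData.cohLim C D ≃* E.H)

/-- **[IUTchII] Prop 3.1 (ii), "equipped with a natural conjugation action by `Π_X(M^Θ_*)`", at the model**:
if the ambient module of `E` is the model cohomology colimit up to a `Π_k`-EQUIVARIANT isomorphism `φ` (the
cyclotomic-rigidity change of coefficients) and the constants are the Kummer image of `𝒪_k̄^▷`, then the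
typed clause `Prop31Statements.constants_stable` HOLDS. [cite: Mochizuki2012, Prop 3.1 (ii) p.88] -/
theorem constants_stable_ofModel
    (hφ : ∀ (g : D.Pi) (y : ModelMLFGaloisData.cohLim C D), φ (D.cohLimConj C g y) = E.conj g (φ y))
    (hrange : MonoidHom.mrange (φ.toMonoidHom.comp (D.constantsKummerHom C)) = E.constants) :
    E.IsConjStable E.constantMonoid :=
  constants_stable_transport E (MulDistribMulAction.toMulAut D.Pi (nonzeroIntegers C.k C.K))
    (D.cohLimConj C) (D.constantsKummerHom C) φ hrange
    (fun g m => D.constantsKummerHom_smul C g m) hφ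

/-- **[IUTchII] Prop 3.1 (ii), "a 'monoid of constants' … naturally isomorphic to `O^▷_{F̄_v}` … equipped with
a natural conjugation action", at the model**: under the same identifications there is an isomorphism of
monoids `𝒪_k̄^▷ ⥲ Ψ_cns(M^Θ_*)` which is the (transported) Kummer map on elements and intertwines the
`Π_k`-action on `𝒪_k̄^▷` with the conjugation action on `Ψ_cns`. [cite: Mochizuki2012, Prop 3.1 (ii) p.88] -/
theorem exists_constantMonoid_mulEquiv_ofModel
    (hφ : ∀ (g : D.Pi) (y : ModelMLFGaloisData.cohLim C D), φ (D.cohLimConj C g y) = E.conj g (φ y))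
    (hrange : MonoidHom.mrange (φ.toMonoidHom.comp (D.constantsKummerHom C)) = E.constants) :
    ∃ e : nonzeroIntegers C.k C.K ≃* E.constantMonoid,
      (∀ m, ((e m : E.constantMonoid) : E.H) = φ (D.constantsKummerHom C m)) ∧
        ∀ (g : D.Pi) (m : nonzeroIntegers C.k C.K),
          ((e (g • m) : E.constantMonoid) : E.H) = E.conj g ((e m : E.constantMonoid) : E.H) :=
  exists_constantMonoid_mulEquiv_transport E (MulDistribMulAction.toMulAut D.Pi (nonzeroIntegers C.k C.K))
    (D.cohLimConj C) (D.constantsKummerHom C) φ (D.constantsKummerHom_injective C) hrange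
    (fun g m => D.constantsKummerHom_smul C g m) hφ

/-- **"naturally"**: the isomorphism `𝒪_k̄^▷ ⥲ Ψ_cns` commuting with the (transported) Kummer map is UNIQUE.
[cite: Mochizuki2012, Prop 3.1 (ii) p.88] -/
theorem constantMonoid_mulEquiv_ofModel_unique (e e' : nonzeroIntegers C.k C.K ≃* E.constantMonoid)
    (he : ∀ m, ((e m : E.constantMonoid) : E.H) = φ (D.constantsKummerHom C m))
    (he' : ∀ m, ((e' m : E.constantMonoid) : E.H) = φ (D.constantsKummerHom C m)) : e = e' :=
  constantMonoid_mulEquiv_unique E (φ.toMonoidHom.comp (D.constantsKummerHom C)) e e' he he'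

/-- Under the same identifications, the unit group `M^×_TM ⊆ Ψ_cns` of the statement file corresponds to the
units of the monoid `𝒪_k̄^▷` (i.e. `O^×_{F̄_v}`): `φ(κ m) ∈ M^×_TM ↔ IsUnit m`.
[cite: Mochizuki2012, Prop 3.1 (ii) p.88] -/
theorem kummer_mem_units_iff_ofModel
    (hrange : MonoidHom.mrange (φ.toMonoidHom.comp (D.constantsKummerHom C)) = E.constants)
    (m : nonzeroIntegers C.k C.K) : φ (D.constantsKummerHom C m) ∈ E.units ↔ IsUnit m :=
  kummer_mem_units_iff E (φ.toMonoidHom.comp (D.constantsKummerHom C))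
    (φ.injective.comp (D.constantsKummerHom_injective C)) hrange m

/-- … so that `M^×_TM` IS the (transported) Kummer image of the unit group `𝒪_k̄^× ⊆ 𝒪_k̄^▷`.
[cite: Mochizuki2012, Prop 3.1 (ii) p.88] -/
theorem units_coe_eq_image_ofModel
    (hrange : MonoidHom.mrange (φ.toMonoidHom.comp (D.constantsKummerHom C)) = E.constants) :
    (E.units : Set E.H) =
      (fun m => φ (D.constantsKummerHom C m)) '' {m : nonzeroIntegers C.k C.K | IsUnit m} :=
  units_coe_eq_image_isUnit E (φ.toMonoidHom.comp (D.constantsKummerHom C))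
    (φ.injective.comp (D.constantsKummerHom_injective C)) hrange

end Model

end TemperedThetaMonoids

end Literature.IUT.HodgeArakelov
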